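import Summits.BirchSwinnertonDyer.BirchSwinnertonDyer.Theorems.EisensteinPrimesResidualDevissageNonsplitLambdaIdentityAtNonsplit
import Summits.BirchSwinnertonDyer.BirchSwinnertonDyer.Theorems.EisensteinPrimesGrDualNoPTorsionOfPoitouTateAt
import Summits.BirchSwinnertonDyer.BirchSwinnertonDyer.Theorems.EisensteinPrimesGrDualImprimitiveOfPrimitiveChar
import HarnessLib

/-!
# Keller–Yin Thm. 1.4.1's λ-relation at a non-split multiplicative Eisenstein datum WITHOUT CGLS 2022 Prop. 1.2.5 by name:
# `p^{λ(𝔛^{Sf}_f)} · #𝔛^{Sf}_f[p] = p^{λ(𝔛_sub) + λ(𝔛_quot)}` from CGLS Cor. 1.2.6 ×2, Milne I 4.10 (a) + Greenberg 2006 Props. 4.1/4.2/3.2,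
# and the PRIMITIVE unramified (f.g., torsion, μ = 0) triples of the two characters (cell `bsd-eis`, width seat `bsd-line-x2-p2` gen 27;
# crux 4 `BSDpOnCellC` stmt-BirchSwinnertonDyer-19034, line telescope v21 UNCHANGED; P4-a of the C2 programme, evidence #59)

WHY. The prop125-DROP twins of x2-p2 g6's `ResidualDevissageNonsplitLambdaIdentityOfFacts.lambdaInvariant_le_add_of_prop125_of_cor126` /
`…_of_isResidualPairOver` and `…AtNonsplit.lambdaInvariant_le_add_of_isResidualPairOver_of_not_split` — the ONLY place in crux 4's
v21 cone where the DIMENSION clause of `CastellaGrossiLeeSkinner2022.prop125_characterGrSelmerDual_torsion_muZero_dim` is consumed.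
In the twins the binder `(hprop125 : prop125_…)` is REPLACED by the textbook clause `hX` (Milne ADT I 4.10 (a) at the finite place sets of
totally complex fields — a TREE THEOREM at the head), Greenberg 2006 Props. 4.1 / 4.2 / 3.2 by name (`h41 h42 h32` — TREE THEOREMS at the
head) and the PRIMITIVE unramified triples `hprimsub hprimquot : ∀ D : DatumDualData κ γ (charModule ∅ θ·) (bdpData … v̄) ∅, f.g. ∧ Λ-torsion
∧ μ = 0` (Thm. 1.2.2's conclusion in the currency of the tree's character main-conjecture engines
`IwasawaTwoVariable.charMainConj_muLambda_free_of_facts` / `ResidualPairMuLambdaOfPub.omegaSide_ofPoitouTateAt_of_firstUnit`). Inside,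
the (f.g., torsion, `μ = 0`) triple of the strict `Sf`-imprimitive duals is this seat's
`GrDualImprimitiveOfPrimitiveChar.grDual_moduleFinite_isTorsion_muZero_of_unrDual_primitive` (p789816) and their ℤ_p-freeness is
`GrDualNoPTorsion.grDual_smul_eq_zero_imp_ofPoitouTateAt` (p791489); everything else is the original proof term token for token
(`lambdaInvariant_le_add_of_grDualData_of_cor126`, x2-p2 g6).

HONEST FRAMING: theorems only (no definition, no named fact, no `sorry`, no instance); CONDITIONAL on CGLS Cor. 1.2.6 ×2 (`hlift`,
`hlocal`, on the line's list), the textbook/tree facts `hX h41 h42 h32`, and the primitive triples (to be discharged at the count level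
from BCGKPST Thm. 3.3.1 / de Shalit II.6.4 / Hida Thm. I, P4-b…); closes no stub, discharges no Literature fact, moves no count (27 names
by name of record); nothing is «redundant» until the closure lands (host (C2)); BSD is proved for no curve.

References: [CastellaGrossiLeeSkinner2022] §1.2 Prop. 1.2.5 (proof), Cor. 1.2.6, §1.4 Props. 1.4.1–1.4.2, Cor. 1.4.3 (arXiv:2008.02571);
[KellerYin2024] Thm. 1.4.1, Lemma 5.1.1, §5.1 (arXiv:2402.12781v2); [Greenberg2016Selmer] Prop. 4.1.1 (c); [Greenberg2006] Props. 3.2, 4.1,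
4.2; [MilneADT2006] I Thm. 4.10 (a); [GreenbergVatsal2000] §2 Cor. (2.3), Prop. (2.8).
-/

set_option autoImplicit false
set_option linter.dupNamespace false -- the summit namespace `…BirchSwinnertonDyer.BirchSwinnertonDyer.Theorems` (Sub = Summit, D-0017) trips it

noncomputable section

open scoped Classical Pointwise

namespace Summit.BirchSwinnertonDyer.BirchSwinnertonDyer.Theorems.ResidualDevissageNonsplitLambdaIdentityOfPrimitive

open WeierstrassCurve NumberField IsDedekindDomain Field
  Literature.NumberTheory.EllipticCurves Literature.NumberTheory.EllipticCurves.IwasawaAlgebra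
  Literature.NumberTheory.EllipticCurves.GreenbergSelmer
  Literature.NumberTheory.EllipticCurves.GreenbergVatsal2000
  Literature.NumberTheory.GaloisRepresentations IsDedekindDomain.HeightOneSpectrum
  Literature.NumberTheory.EllipticCurves.Rank1Residual Literature.NumberTheory.EllipticCurves.KellerYin2024
  Literature.NumberTheory.IwasawaTheory Literature.NumberTheory.IwasawaTheory.Greenberg2006
  Summit.BirchSwinnertonDyer.Rank1Residual.X11b Summit.BirchSwinnertonDyer.Rank1Residual.X11b.AcSelmer
  Summit.BirchSwinnertonDyer.Rank1Residual.X2.ResidualDevissageModules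
  Summit.BirchSwinnertonDyer.BirchSwinnertonDyer.Theorems
  Summit.BirchSwinnertonDyer.BirchSwinnertonDyer.Theorems.ResidualDevissageNonsplitLocalData
  Summit.BirchSwinnertonDyer.BirchSwinnertonDyer.Theorems.ResidualDevissageNonsplitSurjective
  Summit.BirchSwinnertonDyer.BirchSwinnertonDyer.Theorems.ResidualDevissageNonsplitLambdaIdentity
  Summit.BirchSwinnertonDyer.BirchSwinnertonDyer.Theorems.ResidualDevissageNonsplitLambdaIdentityOfFacts
  Summit.BirchSwinnertonDyer.BirchSwinnertonDyer.Theorems.ResidualDevissageNonsplitLambdaIdentityAtNonsplit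
  Summit.BirchSwinnertonDyer.BirchSwinnertonDyer.Theorems.CharResidualStrictSelmerCount
  Summit.BirchSwinnertonDyer.BirchSwinnertonDyer.Theorems.CumulativeHeegnerInclusionAtThreeResidualDevissage
open Literature.NumberTheory.EllipticCurves.CastellaGrossiLeeSkinner2022
  (cor126_residualCharacter_globalLift cor126_residualCharacter_localSurjective)

variable {p : ℕ} [hp : Fact p.Prime]

/-! ### §2 The λ-relation modulo CGLS22 Cor. 1.2.6 + the primitive triples, along a stable line with Teichmüller characters -/

/-- **[prop125-DROP twin: `(hprop125 : prop125_characterGrSelmerDual_torsion_muZero_dim)` ↦ `(hX) (h41) (h42) (h32)` + the PRIMITIVE unramified triples `hprimsub`, `hprimquot` (the char-MC engines' currency); the (f.g., torsion, `μ = 0`) triple at `Sf` now comes from x2-p2 g27's `GrDualImprimitiveOfPrimitiveChar.grDual_moduleFinite_isTorsion_muZero_of_unrDual_primitive` and ℤ_p-freeness from `GrDualNoPTorsion.grDual_smul_eq_zero_imp_ofPoitouTateAt` (Milne I 4.10 (a) + Greenberg 2006 Props. 4.1/4.2/3.2, h411-free), so CGLS Prop. 1.2.5 is NOT a hypothesis;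 the original docstring follows with that substitution.]** **CGLS22 Cor. 1.2.6 [PUBLISHED] + primitive triples ⟹ `p^{λ(X^{Sf})} · #X^{Sf}[p] = p^{λ(𝔛_sub) + λ(𝔛_quot)}`, so
`λ(X^{Sf}) ≤ λ(𝔛_sub) + λ(𝔛_quot)`, with EQUALITY if `X^{Sf}` has no `p`-torsion** — Keller–Yin Thm. 1.4.1's λ-identity
(non-anomalous form) along a `Γ_K`-stable line `S ≤ E_K[p]` whose two characters avoid `{𝟙, ω}` at `v̄`. `E = W/ℚ` base-changed to an
imaginary quadratic `K` (Heegner for `N_E`, `(p)` split, `2 < p`), `v̄ ∋ p` the strict place, `κ` anticyclotomic with topological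
generator `γ`, `Sf` = the places of `K` over `N_E` off `p`, `X^{Sf} = AcSelmer.XAc E_K p κ v̄ ↑Sf γ` (Keller–Yin's `𝔛^S_f`);
`θsub`, `θquot` Teichmüller-valued with equivariant embeddings `S ↪ (F/𝒪)(θsub)`, `E_K[p]/S ↪ (F/𝒪)(θquot)` onto the `p`-torsion;
`𝔛_sub = Dsub.X`, `𝔛_quot = Dquot.X` ANY strict dual data (CGLS's `𝔛^S_φ`, `𝔛^S_ψ`). Part 4's hypotheses on the character duals are
supplied thus: f.g. torsion `μ = 0` at `Sf` from the primitive unramified triples `hprimsub`/`hprimquot` (GV Cor. (2.3) strict twin +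
finite decomposition + the strict/unramified bridge, `θ|_{G_v̄} ≠ 𝟙` transferred along the embeddings, §1), `ℤ_p`-freeness from the
almost-divisibility of the character deformation's strict-at-`v̄` Selmer group (Poitou–Tate fed). The ONE remaining E-level input of the EQUALITY is
«`X^{Sf}[p] = 0`» (CGLS Cor. 1.4.3), kept as a hypothesis of the last clause.
[cite: CastellaGrossiLeeSkinner2022, §1.2 Prop. 1.2.5, Cor. 1.2.6, §1.4 Props. 1.4.1–1.4.2, Cor. 1.4.3 (e-print TeX L681–905; arXiv:2008.02571 Prop. 14, Cor. 15, Props. 17–19)]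
[cite: KellerYin2024, Thm. 1.4.1 (arXiv:2402.12781v2 TeX L1087–1098)] [cite: GreenbergVatsal2000, §2 Prop. (2.8)] -/
theorem lambdaInvariant_le_add_of_primitive_of_cor126
    (hX : ∀ (L : Type) [Field L] [NumberField L] [IsTotallyComplex L] (S : Set (HeightOneSpectrum (𝓞 L))),
      S.Finite → Literature.NumberTheory.GaloisCohomology.poitouTate_shaRestricted_tateDual_natural_at L S)
    (h41 : prop41_globalEulerPoincareCorank) (h42 : prop42_localEulerPoincareCorank)
    (h32 : prop32_cohomology_isCofinitelyGenerated)
    (hlift : cor126_residualCharacter_globalLift) (hlocal : cor126_residualCharacter_localSurjective)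
    (W : WeierstrassCurve ℚ) [W.IsElliptic]
    (K : Type) [Field K] [NumberField K] (vbar : HeightOneSpectrum (𝓞 K))
    (κ : ZpExtension K p) (γ : absoluteGaloisGroup K) [hγ : Fact (κ.IsTopGenerator γ)]
    (Sf : Finset (HeightOneSpectrum (𝓞 K)))
    (hp2 : 2 < p) (hK : IsImaginaryQuadratic K) (hH : SatisfiesHeegnerHypothesis (W.conductorNorm ℤ) K)
    (hsplit : ((Ideal.span {(p : ℤ)}).primesOver (𝓞 K)).ncard = 2)
    (hvbar : ((p : ℕ) : 𝓞 K) ∈ vbar.asIdeal) (hκ : κ.IsAnticyclotomic)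
    (hSf : ∀ w : HeightOneSpectrum (𝓞 K), w ∈ Sf ↔
      (((W.conductorNorm ℤ : ℤ) : 𝓞 K) ∈ w.asIdeal ∧ ((p : ℕ) : 𝓞 K) ∉ w.asIdeal))
    (S : StableSubgroup (absoluteGaloisGroup K) ((W.baseChange K).geomTorsion ((p : ℕ) : ℤ)))
    (hSub : Nat.card S.Sub = p) (hQuot : Nat.card S.Quot = p)
    (hnon1 : ¬ ∀ g ∈ decomp vbar, ∀ x : S.Sub, g • x = x) (hnon2 : ¬ ∀ g ∈ decomp vbar, ∀ y : S.Quot, g • y = y)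
    (hωS : ¬ ∀ g ∈ decomp vbar, ∀ m : S.Sub,
      g • m = ((modNCyclotomicCharacter K p g : (ZMod p)ˣ) : ZMod p).val • m)
    (θsub θquot : FramedGaloisRep K (padicCoeffIntegers (∅ : Set (PadicAlgCl p))) 1)
    (hθsub : ∀ σ : absoluteGaloisGroup K, θsub σ ^ (p - 1) = 1)
    (hθquot : ∀ σ : absoluteGaloisGroup K, θquot σ ^ (p - 1) = 1)
    (jsub : S.Sub →+ charModule (∅ : Set (PadicAlgCl p)) θsub)
    (hjsub : ∀ (σ : absoluteGaloisGroup K) (a : S.Sub), jsub (σ • a) = σ • jsub a) (hjsub_inj : Function.Injective jsub)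
    (hjsub_range : ∀ x : charModule (∅ : Set (PadicAlgCl p)) θsub, x ∈ jsub.range ↔ p • x = 0)
    (jquot : S.Quot →+ charModule (∅ : Set (PadicAlgCl p)) θquot)
    (hjquot : ∀ (σ : absoluteGaloisGroup K) (a : S.Quot), jquot (σ • a) = σ • jquot a)
    (hjquot_inj : Function.Injective jquot)
    (hjquot_range : ∀ x : charModule (∅ : Set (PadicAlgCl p)) θquot, x ∈ jquot.range ↔ p • x = 0)
    (hprimsub : ∀ D : DatumDualData κ γ (charModule (∅ : Set (PadicAlgCl p)) θsub)
      (Castella2018.AcSelmer.bdpData (charModule (∅ : Set (PadicAlgCl p)) θsub) p vbar) (∅ : Set (HeightOneSpectrum (𝓞 K))),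
      Module.Finite (IwasawaAlgebra p) D.X ∧ Module.IsTorsion (IwasawaAlgebra p) D.X ∧ muInvariant p D.X = 0)
    (hprimquot : ∀ D : DatumDualData κ γ (charModule (∅ : Set (PadicAlgCl p)) θquot)
      (Castella2018.AcSelmer.bdpData (charModule (∅ : Set (PadicAlgCl p)) θquot) p vbar) (∅ : Set (HeightOneSpectrum (𝓞 K))),
      Module.Finite (IwasawaAlgebra p) D.X ∧ Module.IsTorsion (IwasawaAlgebra p) D.X ∧ muInvariant p D.X = 0)
    (Dsub : GrDualData κ (charModule (∅ : Set (PadicAlgCl p)) θsub) vbar (↑Sf : Set (HeightOneSpectrum (𝓞 K))) γ)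
    (Dquot : GrDualData κ (charModule (∅ : Set (PadicAlgCl p)) θquot) vbar (↑Sf : Set (HeightOneSpectrum (𝓞 K))) γ) :
    p ^ lambdaInvariant p (XAc (W.baseChange K) p κ vbar (↑Sf : Set (HeightOneSpectrum (𝓞 K))) γ) *
          Nat.card {x : XAc (W.baseChange K) p κ vbar (↑Sf : Set (HeightOneSpectrum (𝓞 K))) γ // p • x = 0} =
        p ^ (lambdaInvariant p Dsub.X + lambdaInvariant p Dquot.X) ∧
      lambdaInvariant p (XAc (W.baseChange K) p κ vbar (↑Sf : Set (HeightOneSpectrum (𝓞 K))) γ) ≤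
        lambdaInvariant p Dsub.X + lambdaInvariant p Dquot.X ∧
      ((∀ x : XAc (W.baseChange K) p κ vbar (↑Sf : Set (HeightOneSpectrum (𝓞 K))) γ, p • x = 0 → x = 0) →
        lambdaInvariant p (XAc (W.baseChange K) p κ vbar (↑Sf : Set (HeightOneSpectrum (𝓞 K))) γ) =
          lambdaInvariant p Dsub.X + lambdaInvariant p Dquot.X) := by
  have hpp : p.Prime := hp.out
  have hp2' : p ≠ 2 := by omega
  haveI hEK : (W.baseChange K).IsElliptic := inferInstanceAs (W.map (algebraMap ℚ K)).IsElliptic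
  obtain ⟨hS₀mem, hgood⟩ := sf_split_and_good (p := p) W K Sf hH hSf
  have hS₀fin : (↑Sf : Set (HeightOneSpectrum (𝓞 K))).Finite := Sf.finite_toSet
  -- unramifiedness of `S`, `E_K[p]/S` outside `Sf ∪ {w ∣ p}`, transported to the two character modules
  have hunrE : ∀ w : HeightOneSpectrum (𝓞 K), w ∉ (↑Sf : Set (HeightOneSpectrum (𝓞 K))) → ((p : ℕ) : 𝓞 K) ∉ w.asIdeal →
      ∀ x ∈ inertia w, ∀ m : (W.baseChange K).geomTorsion ((p : ℕ) : ℤ), x • m = m :=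
    fun w hw hpw x hx m ↦ smul_geomTorsion_eq_of_mem_inertia_chosen (W.baseChange K) (hgood w hw hpw) hpw hx m
  have hunrSub : ∀ w : HeightOneSpectrum (𝓞 K), w ∉ (↑Sf : Set (HeightOneSpectrum (𝓞 K))) → ((p : ℕ) : 𝓞 K) ∉ w.asIdeal →
      ∀ x ∈ inertia w, ∀ m : charModule (∅ : Set (PadicAlgCl p)) θsub, p • m = 0 → x • m = m :=
    fun w hw hpw ↦ (forall_smul_eq_iff_of_embedding θsub jsub hjsub hjsub_inj hjsub_range (inertia w)).mp
      fun x hx a ↦ S.incl_injective (by rw [StableSubgroup.incl_smul]; exact hunrE w hw hpw x hx _)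
  have hunrQuot : ∀ w : HeightOneSpectrum (𝓞 K), w ∉ (↑Sf : Set (HeightOneSpectrum (𝓞 K))) → ((p : ℕ) : 𝓞 K) ∉ w.asIdeal →
      ∀ x ∈ inertia w, ∀ m : charModule (∅ : Set (PadicAlgCl p)) θquot, p • m = 0 → x • m = m :=
    fun w hw hpw ↦ (forall_smul_eq_iff_of_embedding θquot jquot hjquot hjquot_inj hjquot_range (inertia w)).mp
      fun x hx a ↦ by
        obtain ⟨n, rfl⟩ := S.proj_surjective a
        rw [StableSubgroup.smul_proj, hunrE w hw hpw x hx]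
  -- the four local hypotheses at `v̄`, transported
  have hne1sub := fun h ↦ hnon1 ((forall_smul_eq_iff_of_embedding θsub jsub hjsub hjsub_inj hjsub_range (decomp vbar)).mpr h)
  have hne1quot := fun h ↦ hnon2 ((forall_smul_eq_iff_of_embedding θquot jquot hjquot hjquot_inj hjquot_range (decomp vbar)).mpr h)
  have hneωsub := fun h ↦
    hωS ((forall_smul_eq_cyclotomic_iff_of_embedding θsub jsub hjsub hjsub_inj hjsub_range (decomp vbar)).mpr h)
  -- the (f.g., torsion, `μ = 0`) triple at `Sf` FROM the primitive unramified triple (bricks #1–#3) …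
  have hSmem : ∀ v ∈ Sf, ((p : ℕ) : 𝓞 K) ∉ v.asIdeal ∧ ((v.asIdeal.under ℤ).primesOver (𝓞 K)).ncard = 2 :=
    fun v hv ↦ hS₀mem v (Finset.mem_coe.mpr hv)
  have hunrSub' : ∀ v : HeightOneSpectrum (𝓞 K), v ∉ Sf → ((p : ℕ) : 𝓞 K) ∉ v.asIdeal →
      ∀ x ∈ inertia v, ∀ m : charModule (∅ : Set (PadicAlgCl p)) θsub, p • m = 0 → x • m = m :=
    fun v hv ↦ hunrSub v (fun h ↦ hv (Finset.mem_coe.mp h))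
  have hunrQuot' : ∀ v : HeightOneSpectrum (𝓞 K), v ∉ Sf → ((p : ℕ) : 𝓞 K) ∉ v.asIdeal →
      ∀ x ∈ inertia v, ∀ m : charModule (∅ : Set (PadicAlgCl p)) θquot, p • m = 0 → x • m = m :=
    fun v hv ↦ hunrQuot v (fun h ↦ hv (Finset.mem_coe.mp h))
  obtain ⟨hfgsub, hTsub, hμsub⟩ :=
    GrDualImprimitiveOfPrimitiveChar.grDual_moduleFinite_isTorsion_muZero_of_unrDual_primitive hK hp2' κ hκ hγ.out vbar θsub
      hθsub hne1sub Sf hSmem hprimsub Dsub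
  obtain ⟨hfgquot, hTquot, hμquot⟩ :=
    GrDualImprimitiveOfPrimitiveChar.grDual_moduleFinite_isTorsion_muZero_of_unrDual_primitive hK hp2' κ hκ hγ.out vbar θquot
      hθquot hne1quot Sf hSmem hprimquot Dquot
  haveI := hfgsub
  haveI := hfgquot
  -- … and ℤ_p-freeness («no `p`-torsion») from Greenberg's almost-divisibility road (bricks #4–#5), NOT from the dimension clause
  have hfreesub : ∀ x : Dsub.X, p • x = 0 → x = 0 :=
    GrDualNoPTorsion.grDual_smul_eq_zero_imp_ofPoitouTateAt hX h41 h42 h32 hK hp2' hsplit κ hκ γ vbar hvbar θsub hθsub Sf hSmem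
      hunrSub' Dsub hTsub hμsub
  have hfreequot : ∀ x : Dquot.X, p • x = 0 → x = 0 :=
    GrDualNoPTorsion.grDual_smul_eq_zero_imp_ofPoitouTateAt hX h41 h42 h32 hK hp2' hsplit κ hκ γ vbar hvbar θquot hθquot Sf hSmem
      hunrQuot' Dquot hTquot hμquot
  exact lambdaInvariant_le_add_of_grDualData_of_cor126 hlift hlocal W K vbar κ γ Sf hp2 hK hH hsplit hvbar hκ hSf S hSub hQuot
    hnon1 hnon2 hωS θsub θquot hθsub hθquot jsub hjsub hjsub_inj hjsub_range jquot hjquot hjquot_inj hjquot_range Dsub Dquot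
    hTsub hμsub hTquot hμquot hfreesub hfreequot

/-! ### §3 Keyed on a residual pair of `E_K[p]` (the x1 cell's currency) -/

/-- **[prop125-DROP twin: `(hprop125 : prop125_characterGrSelmerDual_torsion_muZero_dim)` ↦ `(hX) (h41) (h42) (h32)` + the PRIMITIVE unramified triples `hprimsub`, `hprimquot` (the char-MC engines' currency); the (f.g., torsion, `μ = 0`) triple at `Sf` now comes from x2-p2 g27's `GrDualImprimitiveOfPrimitiveChar.grDual_moduleFinite_isTorsion_muZero_of_unrDual_primitive` and ℤ_p-freeness from `GrDualNoPTorsion.grDual_smul_eq_zero_imp_ofPoitouTateAt` (Milne I 4.10 (a) + Greenberg 2006 Props. 4.1/4.2/3.2, h411-free), so CGLS Prop. 1.2.5 is NOT a hypothesis; the original docstring follows with that substitution.]** **CGLS22 Cor. 1.2.6 [PUBLISHED] + primitive triples ⟹ `λ(𝔛^{Sf}_f) ≤ λ(𝔛^{Sf}_{θsub}) + λ(𝔛^{Sf}_{θquot})`, with equality if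
`𝔛^{Sf}_f` has no `p`-torsion, at a RESIDUAL PAIR `(θsub, θquot)` of `E_K[p]` whose two residual characters avoid `{𝟙, ω}` at `v̄`**
(`KellerYin2024.IsResidualPairOver (W.baseChange K) p θsub θquot`; the local hypotheses are stated on the `p`-torsion of
`(F/𝒪)(θsub)`, `(F/𝒪)(θquot)` exactly as in CGLS Prop. 1.2.5 (only «`≠ 𝟙`» at `v̄` is used for `θsub`, `θquot`; «`≠ ω`» only for `θsub`); `𝔛^{Sf}_θ = D.X` for ANY strict dual data; datum as in §2). Keller–Yin
Thm. 1.4.1: «If `φ|_{G_p} = ω` … `λ(𝔛^S_f) = λ(𝔛^S_φ) + λ(𝔛^S_ψ)`»; here the CGLS regime `φ|_{G_p} ≠ 𝟙, ω` (good non-anomalous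
or non-split multiplicative `p`) with the equality's one E-level input («`𝔛^{Sf}_f` has no finite part», CGLS Cor. 1.4.3) kept as a
hypothesis. §2 applied to the stable line of `ResidualPairStableLine.exists_stableLine_of_isResidualPairOver`, the local hypotheses
transferred by §1. [cite: KellerYin2024, Thm. 1.4.1 and §1.4 display (char to f) (arXiv:2402.12781v2 TeX L1063–1098)]
[cite: CastellaGrossiLeeSkinner2022, §1.2 Prop. 1.2.5, Cor. 1.2.6, §1.4 Props. 1.4.1–1.4.2, Cor. 1.4.3 (e-print TeX L681–905)] -/
theorem lambdaInvariant_le_add_of_isResidualPairOver_of_primitive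
    (hX : ∀ (L : Type) [Field L] [NumberField L] [IsTotallyComplex L] (S : Set (HeightOneSpectrum (𝓞 L))),
      S.Finite → Literature.NumberTheory.GaloisCohomology.poitouTate_shaRestricted_tateDual_natural_at L S)
    (h41 : prop41_globalEulerPoincareCorank) (h42 : prop42_localEulerPoincareCorank)
    (h32 : prop32_cohomology_isCofinitelyGenerated)
    (hlift : cor126_residualCharacter_globalLift) (hlocal : cor126_residualCharacter_localSurjective)
    (W : WeierstrassCurve ℚ) [W.IsElliptic]
    (K : Type) [Field K] [NumberField K] (vbar : HeightOneSpectrum (𝓞 K))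
    (κ : ZpExtension K p) (γ : absoluteGaloisGroup K) [Fact (κ.IsTopGenerator γ)]
    (Sf : Finset (HeightOneSpectrum (𝓞 K)))
    (hp2 : 2 < p) (hK : IsImaginaryQuadratic K) (hH : SatisfiesHeegnerHypothesis (W.conductorNorm ℤ) K)
    (hsplit : ((Ideal.span {(p : ℤ)}).primesOver (𝓞 K)).ncard = 2)
    (hvbar : ((p : ℕ) : 𝓞 K) ∈ vbar.asIdeal) (hκ : κ.IsAnticyclotomic)
    (hSf : ∀ w : HeightOneSpectrum (𝓞 K), w ∈ Sf ↔
      (((W.conductorNorm ℤ : ℤ) : 𝓞 K) ∈ w.asIdeal ∧ ((p : ℕ) : 𝓞 K) ∉ w.asIdeal))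
    (θsub θquot : FramedGaloisRep K (padicCoeffIntegers (∅ : Set (PadicAlgCl p))) 1)
    (hpair : IsResidualPairOver (W.baseChange K) p θsub θquot)
    (hne1sub : ¬ ∀ g ∈ decomp vbar, ∀ m : charModule (∅ : Set (PadicAlgCl p)) θsub, p • m = 0 → g • m = m)
    (hneωsub : ¬ ∀ g ∈ decomp vbar, ∀ m : charModule (∅ : Set (PadicAlgCl p)) θsub, p • m = 0 →
      g • m = ((modNCyclotomicCharacter K p g : (ZMod p)ˣ) : ZMod p).val • m)
    (hne1quot : ¬ ∀ g ∈ decomp vbar, ∀ m : charModule (∅ : Set (PadicAlgCl p)) θquot, p • m = 0 → g • m = m)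
    (hprimsub : ∀ D : DatumDualData κ γ (charModule (∅ : Set (PadicAlgCl p)) θsub)
      (Castella2018.AcSelmer.bdpData (charModule (∅ : Set (PadicAlgCl p)) θsub) p vbar) (∅ : Set (HeightOneSpectrum (𝓞 K))),
      Module.Finite (IwasawaAlgebra p) D.X ∧ Module.IsTorsion (IwasawaAlgebra p) D.X ∧ muInvariant p D.X = 0)
    (hprimquot : ∀ D : DatumDualData κ γ (charModule (∅ : Set (PadicAlgCl p)) θquot)
      (Castella2018.AcSelmer.bdpData (charModule (∅ : Set (PadicAlgCl p)) θquot) p vbar) (∅ : Set (HeightOneSpectrum (𝓞 K))),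
      Module.Finite (IwasawaAlgebra p) D.X ∧ Module.IsTorsion (IwasawaAlgebra p) D.X ∧ muInvariant p D.X = 0)
    (Dsub : GrDualData κ (charModule (∅ : Set (PadicAlgCl p)) θsub) vbar (↑Sf : Set (HeightOneSpectrum (𝓞 K))) γ)
    (Dquot : GrDualData κ (charModule (∅ : Set (PadicAlgCl p)) θquot) vbar (↑Sf : Set (HeightOneSpectrum (𝓞 K))) γ) :
    p ^ lambdaInvariant p (XAc (W.baseChange K) p κ vbar (↑Sf : Set (HeightOneSpectrum (𝓞 K))) γ) *
          Nat.card {x : XAc (W.baseChange K) p κ vbar (↑Sf : Set (HeightOneSpectrum (𝓞 K))) γ // p • x = 0} =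
        p ^ (lambdaInvariant p Dsub.X + lambdaInvariant p Dquot.X) ∧
      lambdaInvariant p (XAc (W.baseChange K) p κ vbar (↑Sf : Set (HeightOneSpectrum (𝓞 K))) γ) ≤
        lambdaInvariant p Dsub.X + lambdaInvariant p Dquot.X ∧
      ((∀ x : XAc (W.baseChange K) p κ vbar (↑Sf : Set (HeightOneSpectrum (𝓞 K))) γ, p • x = 0 → x = 0) →
        lambdaInvariant p (XAc (W.baseChange K) p κ vbar (↑Sf : Set (HeightOneSpectrum (𝓞 K))) γ) =
          lambdaInvariant p Dsub.X + lambdaInvariant p Dquot.X) := by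
  haveI hEK : (W.baseChange K).IsElliptic := inferInstanceAs (W.map (algebraMap ℚ K)).IsElliptic
  obtain ⟨S, hSub, hQuot, ⟨jsub, hjsub, hjsub_inj, hjsub_range⟩, ⟨jquot, hjquot, hjquot_inj, hjquot_range⟩⟩ :=
    ResidualPairStableLine.exists_stableLine_of_isResidualPairOver (W.baseChange K) hpair
  have hθsub : ∀ σ : absoluteGaloisGroup K, θsub σ ^ (p - 1) = 1 := fun σ ↦ (hpair.pow_sub_one σ).1
  have hθquot : ∀ σ : absoluteGaloisGroup K, θquot σ ^ (p - 1) = 1 := fun σ ↦ (hpair.pow_sub_one σ).2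
  have hnon1 : ¬ ∀ g ∈ decomp vbar, ∀ x : S.Sub, g • x = x := fun h ↦
    hne1sub ((forall_smul_eq_iff_of_embedding θsub jsub hjsub hjsub_inj hjsub_range (decomp vbar)).mp h)
  have hnon2 : ¬ ∀ g ∈ decomp vbar, ∀ y : S.Quot, g • y = y := fun h ↦
    hne1quot ((forall_smul_eq_iff_of_embedding θquot jquot hjquot hjquot_inj hjquot_range (decomp vbar)).mp h)
  have hωS : ¬ ∀ g ∈ decomp vbar, ∀ m : S.Sub,
      g • m = ((modNCyclotomicCharacter K p g : (ZMod p)ˣ) : ZMod p).val • m := fun h ↦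
    hneωsub ((forall_smul_eq_cyclotomic_iff_of_embedding θsub jsub hjsub hjsub_inj hjsub_range (decomp vbar)).mp h)
  exact lambdaInvariant_le_add_of_primitive_of_cor126 hX h41 h42 h32 hlift hlocal W K vbar κ γ Sf hp2 hK hH hsplit hvbar hκ
    hSf S hSub hQuot hnon1 hnon2 hωS θsub θquot hθsub hθquot jsub hjsub hjsub_inj hjsub_range jquot hjquot hjquot_inj
    hjquot_range hprimsub hprimquot Dsub Dquot

/-! ### §4 (prop125-free) Keller–Yin Thm. 1.4.1's λ-relation for EVERY residual pair at a non-split multiplicative Eisenstein datum -/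

/-- **[prop125-DROP twin: `(hprop125 : prop125_characterGrSelmerDual_torsion_muZero_dim)` ↦ `(hX) (h41) (h42) (h32)` + the PRIMITIVE unramified triples `hprimsub`, `hprimquot` (the char-MC engines' currency); the (f.g., torsion, `μ = 0`) triple at `Sf` now comes from x2-p2 g27's `GrDualImprimitiveOfPrimitiveChar.grDual_moduleFinite_isTorsion_muZero_of_unrDual_primitive` and ℤ_p-freeness from `GrDualNoPTorsion.grDual_smul_eq_zero_imp_ofPoitouTateAt` (Milne I 4.10 (a) + Greenberg 2006 Props. 4.1/4.2/3.2, h411-free), so CGLS Prop. 1.2.5 is NOT a hypothesis; the original docstring follows with that substitution.]** **At every NON-SPLIT multiplicative Eisenstein datum and EVERY residual pair `(θsub, θquot)` of `E_K[p]`: CGLS22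
Cor. 1.2.6 [PUBLISHED] + primitive triples ⟹ `p^{λ(𝔛^{Sf}_f)} · #𝔛^{Sf}_f[p] = p^{λ(𝔛_sub) + λ(𝔛_quot)}`, `λ(𝔛^{Sf}_f) ≤ λ(𝔛_sub) + λ(𝔛_quot)`, and
`=` if `𝔛^{Sf}_f` has no `p`-torsion.** Binders: `W/ℚ` globally minimal, `2 < p`, `p ‖ N` NON-split, `K` imaginary quadratic with the
Heegner hypothesis for `N_E` and `(p)` split, `v̄ ∋ p` the strict place, `κ` anticyclotomic with topological generator `γ`, `Sf` = the
places of `K` over `N_E` off `p`; `𝔛^{Sf}_f = AcSelmer.XAc E_K p κ v̄ ↑Sf γ`; `𝔛_sub = Dsub.X`, `𝔛_quot = Dquot.X` ANY strict dual data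
(`KellerYin2024.GrDualData`) of `(F/𝒪)(θsub)`, `(F/𝒪)(θquot)` — CGLS's `𝔛^S_φ`, `𝔛^S_ψ`. The four local hypotheses of
`lambdaInvariant_le_add_of_isResidualPairOver` are DISCHARGED by §2 (the residual pair's line is `Γ_K`-stable of order `p`). This is
Keller–Yin Thm. 1.4.1's `λ(𝔛^S_f) = λ(𝔛^S_φ) + λ(𝔛^S_ψ)` at `p ‖ N` non-split («whose proof still works in the multiplicative reduction
setting», KY §5.1) in the kernel as `≤` modulo CGLS Cor. 1.2.6 ×2 and the primitive triples only, and as `=` modulo the same plus the ONE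
E-level input «`𝔛^{Sf}_f` has no non-zero finite `Λ`-submodule» (CGLS Cor. 1.4.3), kept as a hypothesis.
[cite: KellerYin2024, Thm. 1.4.1, Lemma 5.1.1 and §5.1 (arXiv:2402.12781v2 TeX L1087–1098, L1744–1778)]
[cite: CastellaGrossiLeeSkinner2022, §1.2 Prop. 1.2.5, Cor. 1.2.6, §1.4 Props. 1.4.1–1.4.2, Cor. 1.4.3 (e-print TeX L681–905)]
[cite: SilvermanATAEC1994, Ch. V Thm. 5.3, Cor. 5.4] -/
theorem lambdaInvariant_le_add_of_isResidualPairOver_of_not_split_of_primitive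
    (hX : ∀ (L : Type) [Field L] [NumberField L] [IsTotallyComplex L] (S : Set (HeightOneSpectrum (𝓞 L))),
      S.Finite → Literature.NumberTheory.GaloisCohomology.poitouTate_shaRestricted_tateDual_natural_at L S)
    (h41 : prop41_globalEulerPoincareCorank) (h42 : prop42_localEulerPoincareCorank)
    (h32 : prop32_cohomology_isCofinitelyGenerated)
    (hlift : cor126_residualCharacter_globalLift) (hlocal : cor126_residualCharacter_localSurjective)
    {p : ℕ} [hp : Fact p.Prime] (W : WeierstrassCurve ℚ) [W.IsElliptic] [W.IsGloballyMinimal]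
    (K : Type) [Field K] [NumberField K] (vbar : HeightOneSpectrum (𝓞 K))
    (κ : ZpExtension K p) (γ : absoluteGaloisGroup K) [Fact (κ.IsTopGenerator γ)]
    (Sf : Finset (HeightOneSpectrum (𝓞 K)))
    (hp2 : 2 < p) (hmult : Mult W p) (hns : ¬ W.HasSplitMultiplicativeReductionAtPrime p)
    (hK : IsImaginaryQuadratic K) (hH : SatisfiesHeegnerHypothesis (W.conductorNorm ℤ) K)
    (hsplit : ((Ideal.span {(p : ℤ)}).primesOver (𝓞 K)).ncard = 2)
    (hvbar : ((p : ℕ) : 𝓞 K) ∈ vbar.asIdeal) (hκ : κ.IsAnticyclotomic)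
    (hSf : ∀ w : HeightOneSpectrum (𝓞 K), w ∈ Sf ↔
      (((W.conductorNorm ℤ : ℤ) : 𝓞 K) ∈ w.asIdeal ∧ ((p : ℕ) : 𝓞 K) ∉ w.asIdeal))
    (θsub θquot : FramedGaloisRep K (padicCoeffIntegers (∅ : Set (PadicAlgCl p))) 1)
    (hpair : IsResidualPairOver (W.baseChange K) p θsub θquot)
    (hprimsub : ∀ D : DatumDualData κ γ (charModule (∅ : Set (PadicAlgCl p)) θsub)
      (Castella2018.AcSelmer.bdpData (charModule (∅ : Set (PadicAlgCl p)) θsub) p vbar) (∅ : Set (HeightOneSpectrum (𝓞 K))),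
      Module.Finite (IwasawaAlgebra p) D.X ∧ Module.IsTorsion (IwasawaAlgebra p) D.X ∧ muInvariant p D.X = 0)
    (hprimquot : ∀ D : DatumDualData κ γ (charModule (∅ : Set (PadicAlgCl p)) θquot)
      (Castella2018.AcSelmer.bdpData (charModule (∅ : Set (PadicAlgCl p)) θquot) p vbar) (∅ : Set (HeightOneSpectrum (𝓞 K))),
      Module.Finite (IwasawaAlgebra p) D.X ∧ Module.IsTorsion (IwasawaAlgebra p) D.X ∧ muInvariant p D.X = 0)
    (Dsub : GrDualData κ (charModule (∅ : Set (PadicAlgCl p)) θsub) vbar (↑Sf : Set (HeightOneSpectrum (𝓞 K))) γ)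
    (Dquot : GrDualData κ (charModule (∅ : Set (PadicAlgCl p)) θquot) vbar (↑Sf : Set (HeightOneSpectrum (𝓞 K))) γ) :
    p ^ lambdaInvariant p (XAc (W.baseChange K) p κ vbar (↑Sf : Set (HeightOneSpectrum (𝓞 K))) γ) *
          Nat.card {x : XAc (W.baseChange K) p κ vbar (↑Sf : Set (HeightOneSpectrum (𝓞 K))) γ // p • x = 0} =
        p ^ (lambdaInvariant p Dsub.X + lambdaInvariant p Dquot.X) ∧
      lambdaInvariant p (XAc (W.baseChange K) p κ vbar (↑Sf : Set (HeightOneSpectrum (𝓞 K))) γ) ≤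
        lambdaInvariant p Dsub.X + lambdaInvariant p Dquot.X ∧
      ((∀ x : XAc (W.baseChange K) p κ vbar (↑Sf : Set (HeightOneSpectrum (𝓞 K))) γ, p • x = 0 → x = 0) →
        lambdaInvariant p (XAc (W.baseChange K) p κ vbar (↑Sf : Set (HeightOneSpectrum (𝓞 K))) γ) =
          lambdaInvariant p Dsub.X + lambdaInvariant p Dquot.X) := by
  haveI hEK : (W.baseChange K).IsElliptic := inferInstanceAs (W.map (algebraMap ℚ K)).IsElliptic
  -- the residual pair's line and its local data at `v̄`
  obtain ⟨S, hSub, -, ⟨jsub, hjsub, hjsub_inj, hjsub_range⟩, ⟨jquot, hjquot, hjquot_inj, hjquot_range⟩⟩ :=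
    ResidualPairStableLine.exists_stableLine_of_isResidualPairOver (W.baseChange K) hpair
  obtain ⟨-, hnon1, hnon2, hωS, -, -⟩ := localData_of_not_split W K vbar κ hp2 hmult hns hK hsplit hvbar S hSub
  -- in the currency of the character modules
  have hne1sub := fun h ↦ hnon1 ((forall_smul_eq_iff_of_embedding θsub jsub hjsub hjsub_inj hjsub_range (decomp vbar)).mpr h)
  have hne1quot := fun h ↦ hnon2 ((forall_smul_eq_iff_of_embedding θquot jquot hjquot hjquot_inj hjquot_range (decomp vbar)).mpr h)
  have hneωsub := fun h ↦
    hωS ((forall_smul_eq_cyclotomic_iff_of_embedding θsub jsub hjsub hjsub_inj hjsub_range (decomp vbar)).mpr h)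
  exact lambdaInvariant_le_add_of_isResidualPairOver_of_primitive hX h41 h42 h32 hlift hlocal W K vbar κ γ Sf hp2 hK hH hsplit
    hvbar hκ hSf θsub θquot hpair hne1sub hneωsub hne1quot hprimsub hprimquot Dsub Dquot


end Summit.BirchSwinnertonDyer.BirchSwinnertonDyer.Theorems.ResidualDevissageNonsplitLambdaIdentityOfPrimitive

end
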